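import Summits.ValiantsHypothesis.ValiantsHypothesis.Theorems.LacunarySymmetroidMatrixDescartesDoorA26WallBubblingMomentTail
import Summits.ValiantsHypothesis.ValiantsHypothesis.Theorems.LacunarySymmetroidMatrixDescartesDoorA26WallBubblingMomentTower
import Summits.ValiantsHypothesis.ValiantsHypothesis.Theorems.LacunarySymmetroidMatrixDescartesDoorA26WallBubblingMomentClassLimit
import Summits.ValiantsHypothesis.ValiantsHypothesis.Theorems.LacunarySymmetroidMatrixDescartesDoorA26WallBubblingWeyl321Classes
import Summits.ValiantsHypothesis.ValiantsHypothesis.Theorems.LacunarySymmetroidMatrixDescartesDoorA26WallBubblingWeylTripleDichotomy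
import Summits.ValiantsHypothesis.ValiantsHypothesis.Theorems.LacunarySymmetroidMatrixDescartesDoorA26WallBubblingWeyl321Slots
import Summits.ValiantsHypothesis.ValiantsHypothesis.Theorems.LacunarySymmetroidMatrixDescartesDoorA26WallBubblingConfluentTower

/-!
# Wall bubbling for `DoorA26` — THE STRATUM [3,2,1]: THE FUNCTION-LEVEL LIMIT OF A CLUSTER (door-free)

HONEST FRAMING.  Chain theorem toward `TripleStratum26` of `Cruxes/DoorA26/Lines/wall_bubbling_ConfluentDoor.lean` (rev 13; crux `DoorA26`,
stmt-ValiantsHypothesis-19979 — OPEN, typed, never asserted), pattern [3,2,1] in the positions of chain `h321` of #91 (PAIR `0,1`, SINGLE `2`,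
TRIPLE `3,4,5`, value positions `![0,2,3]`).  W1 seat val-sym-door-p2 g15 (#108); the [3,2,1] clone of #89 `…WeylTripleLimit` in the same
FUNCTION-LEVEL CLASS-MOMENT currency (#81–#83), with the SAME three-letter rigidity dichotomy #88 `weylTriple_dichotomy` applied with both outside
letters equal to the single.  **`weyl321Limit`** — along a subsequence, normalised by the largest head moment (orders `< n_k`,
`n = ![![3,2,6],![2,1,3],![6,3,6]]` on the ordered classes `Fin 3 × Fin 3`), the genuine determinants converge CONTINUOUSLY WITH ALL DERIVATIVES to
`g(s) = Σ_k (Σ_{m<n_k} c_{k,m}s^m/m!) e^{(δ0_{pos k₁}+δ0_{pos k₂})s}` with symmetric coefficients, one non-zero, and the RIGIDITY DICHOTOMY «`c_{(2,2),5} = 0` or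
`c_{(1,1),0} = 0`» (the triple's sixth slot or the single's pure class dies; the PAIR's classes are never touched).  Tails: #81 `momentTail` with member
counts 6 (triple via #84 `tripleMoment_symmetrise`; pair × triple), 3 (single × triple; pair via #106 `pairMoment_symmetrise`), 2 (pair × single).
The window theorem is #109.  Multi-cluster chains and the patterns [3,3]/[4,2] (no single letter) are NOT treated.  Nothing here bears on `DoorA26`,
`MatrixDescartes` (stmt-ValiantsHypothesis-18050) or `VP ≠ VNP`; `TripleStratum26`, (W), (M) OPEN.  `--supports stmt-ValiantsHypothesis-19979 --as helper`.
[this work].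
-/

-- `Summit.ValiantsHypothesis.ValiantsHypothesis.…` repeats a component by the D-0017 layout
-- (single-conjunct summit), which the `dupNamespace` linter flags; the name is mandated.
set_option linter.dupNamespace false
namespace Summit.ValiantsHypothesis.ValiantsHypothesis.Theorems.LacunarySymmetroidMatrixDescartes.WallBubbling

open Finset Filter Topology
open Bubbling (polar polar_apply)

set_option maxHeartbeats 400000 in
/-- **THE FUNCTION-LEVEL LIMIT OF A CLUSTER AT THE STRATUM [3,2,1].**  See the module docstring. [this work] -/
theorem weyl321Limit (δs : ℕ → Fin 6 → ℝ) (δ0 : Fin 6 → ℝ)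
    (hδ : ∀ l, Tendsto (fun ν => δs ν l) atTop (𝓝 (δ0 l))) (h10 : δ0 1 = δ0 0) (h43 : δ0 4 = δ0 3) (h53 : δ0 5 = δ0 3)
    (U : ℕ → Fin 6 → Matrix (Fin 2) (Fin 2) ℝ) (hU : ∀ ν l, (U ν l).IsSymm)
    (hne : ∀ ν, ∃ t, (∑ l, Real.exp (δs ν l * t) • U ν l).det ≠ 0) :
    ∃ φ : ℕ → ℕ, StrictMono φ ∧ ∃ (a : ℕ → ℝ) (c : Fin 3 × Fin 3 → ℕ → ℝ),
      (∀ k m, c k.swap m = c k m) ∧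
      (∃ k m, m < (fun k : Fin 3 × Fin 3 => (![![3, 2, 6], ![2, 1, 3], ![6, 3, 6]] : Fin 3 → Fin 3 → ℕ) k.1 k.2) k ∧ c k m ≠ 0) ∧
      (c (2, 2) 5 = 0 ∨ c (1, 1) 0 = 0) ∧
      ∀ (j : ℕ) (ψ : ℕ → ℕ), StrictMono ψ → ∀ (ts : ℕ → ℝ) (t₀ : ℝ), Tendsto ts atTop (𝓝 t₀) →
        Tendsto (fun l => iteratedDeriv j (fun t => a (ψ l) * (∑ i, Real.exp (δs (φ (ψ l)) i * t) • U (φ (ψ l)) i).det) (ts l))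
          atTop (𝓝 (iteratedDeriv j (fun s => ∑ k : Fin 3 × Fin 3,
            (∑ m ∈ Finset.range ((fun k : Fin 3 × Fin 3 => (![![3, 2, 6], ![2, 1, 3], ![6, 3, 6]] : Fin 3 → Fin 3 → ℕ) k.1 k.2) k),
              c k m * s ^ m / (m.factorial : ℝ))
              * Real.exp ((δ0 ((![0, 2, 3] : Fin 3 → Fin 6) k.1) + δ0 ((![0, 2, 3] : Fin 3 → Fin 6) k.2)) * s)) t₀)) := by
  classical
  set v : Fin 6 → Fin 3 := ![0, 0, 1, 2, 2, 2] with hv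
  set pos : Fin 3 → Fin 6 := ![0, 2, 3] with hpos
  set cls : Fin 6 × Fin 6 → Fin 3 × Fin 3 := fun i => (v i.1, v i.2) with hcls
  set pr : Fin 2 → Fin 6 := ![0, 1] with hpr
  set t6 : Fin 3 → Fin 6 := ![3, 4, 5] with ht6
  set n : Fin 3 × Fin 3 → ℕ := fun k => (![![3, 2, 6], ![2, 1, 3], ![6, 3, 6]] : Fin 3 → Fin 3 → ℕ) k.1 k.2 with hn
  set e : ℕ → Fin 3 → ℝ := fun ν a => δs ν (pos a) with he
  set η : ℕ → Fin 6 → ℝ := fun ν l => δs ν l - δs ν (pos (v l)) with hη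
  set a : ℕ → Fin 6 × Fin 6 → ℝ := fun ν i => polar (U ν i.1) (U ν i.2) with ha
  set ε : ℕ → Fin 6 × Fin 6 → ℝ := fun ν i => η ν i.1 + η ν i.2 with hε
  set wν : ℕ → Fin 3 × Fin 3 → ℝ := fun ν k => e ν k.1 + e ν k.2 with hwν
  set w : Fin 3 × Fin 3 → ℝ := fun k => δ0 (pos k.1) + δ0 (pos k.2) with hw
  set M : ℕ → Fin 3 × Fin 3 → ℕ → ℝ := fun ν k m => ∑ i, (if cls i = k then a ν i else 0) * ε ν i ^ m with hM
  set V : ℕ → Fin 3 → Matrix (Fin 2) (Fin 2) ℝ := fun ν p => U ν (t6 p) with hV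
  set x : ℕ → Fin 3 → ℝ := fun ν p => η ν (t6 p) with hx
  set s : ℕ → ℝ := fun ν => |η ν 1| + |η ν 4| + |η ν 5| with hs
  have h3 : ∀ z : Fin 3, z = 0 ∨ z = 1 ∨ z = 2 := by decide
  have hn_le : ∀ k, n k ≤ 6 := by
    rintro ⟨k1, k2⟩; rcases h3 k1 with rfl | rfl | rfl <;> rcases h3 k2 with rfl | rfl | rfl <;> simp [hn]
  have hn_pos : ∀ k, 0 < n k := by
    rintro ⟨k1, k2⟩; rcases h3 k1 with rfl | rfl | rfl <;> rcases h3 k2 with rfl | rfl | rfl <;> simp [hn]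
  have hn_swap : ∀ k : Fin 3 × Fin 3, n k.swap = n k := by
    rintro ⟨k1, k2⟩; rcases h3 k1 with rfl | rfl | rfl <;> rcases h3 k2 with rfl | rfl | rfl <;> simp [hn]
  obtain ⟨hn00, hn01, hn02, hn11, hn12, hn22⟩ : n (0, 0) = 3 ∧ n (0, 1) = 2 ∧ n (0, 2) = 6 ∧ n (1, 1) = 1 ∧ n (1, 2) = 3 ∧ n (2, 2) = 6 := by
    refine ⟨?_, ?_, ?_, ?_, ?_, ?_⟩ <;> simp [hn]
  have hVsymm : ∀ ν p, (V ν p).IsSymm := fun ν p => hU ν _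
  -- ### deviations
  have hη_cast : ∀ ν (b : Fin 3), η ν (pos b) = 0 := fun ν b => weyl321_eta_pos (δs ν) b
  have hη2 : ∀ ν, η ν 2 = 0 := fun ν => hη_cast ν 1
  have hs0 : ∀ ν, 0 ≤ s ν := fun ν => by positivity
  have hηle : ∀ ν l, |η ν l| ≤ s ν := by
    intro ν l
    have h1 : |η ν 1| ≤ s ν := by simp only [hs]; linarith [abs_nonneg (η ν 4), abs_nonneg (η ν 5)]
    have h4 : |η ν 4| ≤ s ν := by simp only [hs]; linarith [abs_nonneg (η ν 1), abs_nonneg (η ν 5)]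
    have h5 : |η ν 5| ≤ s ν := by simp only [hs]; linarith [abs_nonneg (η ν 1), abs_nonneg (η ν 4)]
    have h0 : ∀ b : Fin 3, |η ν (pos b)| ≤ s ν := fun b => by rw [hη_cast, abs_zero]; exact hs0 ν
    rcases (show l = pos 0 ∨ l = 1 ∨ l = pos 1 ∨ l = pos 2 ∨ l = 4 ∨ l = 5 by fin_cases l <;> decide) with h | h | h | h | h | h <;>
      rw [h] <;> first | exact h0 _ | exact h1 | exact h4 | exact h5
  have hxle : ∀ ν p, |x ν p| ≤ s ν := fun ν p => hηle ν (t6 p)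
  have hεle : ∀ ν i, |ε ν i| ≤ 2 * s ν := by
    intro ν i
    calc |ε ν i| = |η ν i.1 + η ν i.2| := rfl
      _ ≤ |η ν i.1| + |η ν i.2| := abs_add_le _ _
      _ ≤ s ν + s ν := add_le_add (hηle ν _) (hηle ν _)
      _ = 2 * s ν := by ring
  have hslim : Tendsto s atTop (𝓝 0) := by
    have h1 : Tendsto (fun ν => η ν 1) atTop (𝓝 0) := by
      have := (hδ 1).sub (hδ 0)
      rw [h10, sub_self] at this
      exact this
    have h4 : Tendsto (fun ν => η ν 4) atTop (𝓝 0) := by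
      have := (hδ 4).sub (hδ 3)
      rw [h43, sub_self] at this
      exact this
    have h5 : Tendsto (fun ν => η ν 5) atTop (𝓝 0) := by
      have := (hδ 5).sub (hδ 3)
      rw [h53, sub_self] at this
      exact this
    have := ((continuous_abs.tendsto _ |>.comp h1).add (continuous_abs.tendsto _ |>.comp h4)).add (continuous_abs.tendsto _ |>.comp h5)
    simpa [hs] using this
  have hxlim : ∀ p, Tendsto (fun ν => x ν p) atTop (𝓝 0) := by
    intro p
    refine squeeze_zero_norm (fun ν => ?_) hslim
    rw [Real.norm_eq_abs]; exact hxle ν p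
  -- ### the class moments in member / frame language (#106, #84)
  have hMform : ∀ ν (α β : Fin 3) m, M ν (α, β) m
      = ∑ p ∈ (if α = 0 then {0, 1} else if α = 1 then {2} else {3, 4, 5} : Finset (Fin 6)),
          ∑ q ∈ (if β = 0 then {0, 1} else if β = 1 then {2} else {3, 4, 5} : Finset (Fin 6)), polar (U ν p) (U ν q) * (η ν p + η ν q) ^ m :=
    fun ν α β m => classMoment_eq₃₂₁ (U ν) (η ν) m α β
  have hM33 : ∀ ν m, M ν (2, 2) m = ∑ p, ∑ q, polar (V ν p) (V ν q) * (x ν p + x ν q) ^ m := by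
    intro ν m
    rw [hMform]
    simp only [show ((2 : Fin 3) = 0) = False by decide, show ((2 : Fin 3) = 1) = False by decide, if_false]
    rw [sum_fibTriple]
    exact Finset.sum_congr rfl fun p _ => sum_fibTriple _
  have hM12sum : ∀ ν m, M ν (1, 2) m = ∑ q, polar (U ν 2) (V ν q) * x ν q ^ m := by
    intro ν m
    rw [hMform]
    simp only [show ((2 : Fin 3) = 0) = False by decide, show ((2 : Fin 3) = 1) = False by decide, show ((1 : Fin 3) = 0) = False by decide,
      if_false, if_true]
    rw [sum_fibSingle, sum_fibTriple]
    exact Finset.sum_congr rfl fun q _ => by rw [hη2, zero_add]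
  have hM12 : ∀ ν m, M ν (1, 2) m = polar (U ν 2) (∑ q, x ν q ^ m • V ν q) := fun ν m => by rw [hM12sum, mixedMoment_eq_frame]
  have hMswap : ∀ ν k m, M ν k.swap m = M ν k m := fun ν k m => classMoment_swap₃₂₁ (U ν) (η ν) m k
  have hM21 : ∀ ν m, M ν (2, 1) m = polar (∑ q, x ν q ^ m • V ν q) (U ν 2) := fun ν m => by
    rw [show M ν (2, 1) m = M ν (1, 2) m from hMswap ν (1, 2) m, hM12, Bubbling.polar_comm]
  have hM11 : ∀ ν m, M ν (1, 1) m = polar (U ν 2) (U ν 2) * (0 : ℝ) ^ m := by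
    intro ν m
    rw [hMform]
    simp only [show ((1 : Fin 3) = 0) = False by decide, if_false, if_true]
    rw [sum_fibSingle, sum_fibSingle, hη2, add_zero]
  have hM02 : ∀ ν m, M ν (0, 2) m = ∑ pq : Fin 2 × Fin 3, polar (U ν (pr pq.1)) (V ν pq.2) * (η ν (pr pq.1) + x ν pq.2) ^ m := by
    intro ν m
    rw [hMform, Fintype.sum_prod_type]
    simp only [show ((2 : Fin 3) = 0) = False by decide, show ((2 : Fin 3) = 1) = False by decide, if_false, if_true]
    rw [sum_fibPair]
    exact Finset.sum_congr rfl fun p _ => sum_fibTriple _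
  have hM00 : ∀ ν m, M ν (0, 0) m = ∑ p : Fin 2, ∑ q : Fin 2, polar (U ν (pr p)) (U ν (pr q)) * (η ν (pr p) + η ν (pr q)) ^ m := by
    intro ν m
    rw [hMform]
    simp only [if_true]
    rw [sum_fibPair]
    exact Finset.sum_congr rfl fun p _ => sum_fibPair _
  have hM01 : ∀ ν m, M ν (0, 1) m = ∑ p : Fin 2, polar (U ν (pr p)) (U ν 2) * η ν (pr p) ^ m := by
    intro ν m
    rw [hMform]
    simp only [show ((1 : Fin 3) = 0) = False by decide, if_false, if_true]
    rw [sum_fibPair]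
    exact Finset.sum_congr rfl fun p _ => by rw [sum_fibSingle, hη2, add_zero]
  -- ### the moment tails (#81), for levels with `2 s ≤ 1/2`
  obtain ⟨C6, hC6₀, hC6⟩ := momentTail 6
  obtain ⟨C3, hC3₀, hC3⟩ := momentTail 3
  obtain ⟨C2, hC2₀, hC2⟩ := momentTail 2
  set Ct : ℝ := max (max C6 C3) C2 with hCt
  obtain ⟨hC6t, hC3t, hC2t⟩ : C6 ≤ Ct ∧ C3 ≤ Ct ∧ C2 ≤ Ct :=
    ⟨(le_max_left _ _).trans (le_max_left _ _), (le_max_right _ _).trans (le_max_left _ _), le_max_right _ _⟩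
  have hprle : ∀ ν p, |η ν (pr p)| ≤ s ν := fun ν p => hηle ν _
  have htail22 : ∀ ν, 2 * s ν ≤ 1 / 2 → ∀ m, 6 ≤ m → |M ν (2, 2) m| ≤ Ct * (2 * s ν) * ∑ j ∈ Finset.range 6, |M ν (2, 2) j| := by
    intro ν hsν m hm
    have h2s : 0 ≤ 2 * s ν := by positivity
    have key := hC6 (univ.filter fun pq : Fin 3 × Fin 3 => pq.1 ≤ pq.2) (by decide)
      (fun pq => (if pq.1 = pq.2 then 1 else 2) * polar (V ν pq.1) (V ν pq.2)) (fun pq => x ν pq.1 + x ν pq.2) (2 * s ν) h2s hsν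
      (fun pq _ => (abs_add_le _ _).trans (by linarith [hxle ν pq.1, hxle ν pq.2])) m hm
    simp only [hM33, tripleMoment_symmetrise]
    refine key.trans ?_
    gcongr
  have htail12 : ∀ ν, 2 * s ν ≤ 1 / 2 → ∀ m, 3 ≤ m → |M ν (1, 2) m| ≤ Ct * (2 * s ν) * ∑ j ∈ Finset.range 3, |M ν (1, 2) j| := by
    intro ν hsν m hm
    have h2s : 0 ≤ 2 * s ν := by positivity
    have key := hC3 (univ : Finset (Fin 3)) (by simp)
      (fun q => polar (U ν 2) (V ν q)) (fun q => x ν q) (2 * s ν) h2s hsν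
      (fun q _ => (hxle ν q).trans (by linarith [hs0 ν])) m hm
    simp only [hM12sum]
    refine key.trans ?_
    gcongr
  have htail11 : ∀ ν, 2 * s ν ≤ 1 / 2 → ∀ m, 1 ≤ m → |M ν (1, 1) m| ≤ Ct * (2 * s ν) * ∑ j ∈ Finset.range 1, |M ν (1, 1) j| := by
    intro ν hsν m hm
    rw [hM11 ν m, zero_pow (by omega), mul_zero, abs_zero]
    have h2s : 0 ≤ 2 * s ν := by positivity
    have : 0 ≤ Ct := hC6₀.trans hC6t
    positivity
  have htail02 : ∀ ν, 2 * s ν ≤ 1 / 2 → ∀ m, 6 ≤ m → |M ν (0, 2) m| ≤ Ct * (2 * s ν) * ∑ j ∈ Finset.range 6, |M ν (0, 2) j| := by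
    intro ν hsν m hm
    have h2s : 0 ≤ 2 * s ν := by positivity
    have key := hC6 (univ : Finset (Fin 2 × Fin 3)) (by simp)
      (fun pq => polar (U ν (pr pq.1)) (V ν pq.2)) (fun pq => η ν (pr pq.1) + x ν pq.2) (2 * s ν) h2s hsν
      (fun pq _ => (abs_add_le _ _).trans (by linarith [hprle ν pq.1, hxle ν pq.2])) m hm
    simp only [hM02]
    refine key.trans ?_
    gcongr
  have htail00 : ∀ ν, 2 * s ν ≤ 1 / 2 → ∀ m, 3 ≤ m → |M ν (0, 0) m| ≤ Ct * (2 * s ν) * ∑ j ∈ Finset.range 3, |M ν (0, 0) j| := by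
    intro ν hsν m hm
    have h2s : 0 ≤ 2 * s ν := by positivity
    have key := hC3 (univ.filter fun pq : Fin 2 × Fin 2 => pq.1 ≤ pq.2) (by decide)
      (fun pq => (if pq.1 = pq.2 then 1 else 2) * polar (U ν (pr pq.1)) (U ν (pr pq.2))) (fun pq => η ν (pr pq.1) + η ν (pr pq.2))
      (2 * s ν) h2s hsν (fun pq _ => (abs_add_le _ _).trans (by linarith [hprle ν pq.1, hprle ν pq.2])) m hm
    simp only [hM00, pairMoment_symmetrise]
    refine key.trans ?_
    gcongr
  have htail01 : ∀ ν, 2 * s ν ≤ 1 / 2 → ∀ m, 2 ≤ m → |M ν (0, 1) m| ≤ Ct * (2 * s ν) * ∑ j ∈ Finset.range 2, |M ν (0, 1) j| := by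
    intro ν hsν m hm
    have h2s : 0 ≤ 2 * s ν := by positivity
    have key := hC2 (univ : Finset (Fin 2)) (by simp)
      (fun p => polar (U ν (pr p)) (U ν 2)) (fun p => η ν (pr p)) (2 * s ν) h2s hsν
      (fun p _ => (hprle ν p).trans (by linarith [hs0 ν])) m hm
    simp only [hM01]
    refine key.trans ?_
    gcongr
  have htail_lvl : ∀ ν, 2 * s ν ≤ 1 / 2 → ∀ k m, n k ≤ m →
      |M ν k m| ≤ Ct * (2 * s ν) * ∑ j ∈ Finset.range (n k), |M ν k j| := by
    intro ν hsν k m hm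
    obtain ⟨k1, k2⟩ := k
    rcases h3 k1 with rfl | rfl | rfl <;> rcases h3 k2 with rfl | rfl | rfl
    · rw [hn00] at hm ⊢; exact htail00 ν hsν m hm
    · rw [hn01] at hm ⊢; exact htail01 ν hsν m hm
    · rw [hn02] at hm ⊢; exact htail02 ν hsν m hm
    · rw [show n (1, 0) = n (0, 1) from hn_swap (0, 1)] at hm ⊢
      simp only [show ∀ j, M ν (1, 0) j = M ν (0, 1) j from fun j => hMswap ν (0, 1) j]
      rw [hn01] at hm ⊢; exact htail01 ν hsν m hm
    · rw [hn11] at hm ⊢; exact htail11 ν hsν m hm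
    · rw [hn12] at hm ⊢; exact htail12 ν hsν m hm
    · rw [show n (2, 0) = n (0, 2) from hn_swap (0, 2)] at hm ⊢
      simp only [show ∀ j, M ν (2, 0) j = M ν (0, 2) j from fun j => hMswap ν (0, 2) j]
      rw [hn02] at hm ⊢; exact htail02 ν hsν m hm
    · rw [show n (2, 1) = n (1, 2) from hn_swap (1, 2)] at hm ⊢
      simp only [show ∀ j, M ν (2, 1) j = M ν (1, 2) j from fun j => hMswap ν (1, 2) j]
      rw [hn12] at hm ⊢; exact htail12 ν hsν m hm
    · rw [hn22] at hm ⊢; exact htail22 ν hsν m hm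
  -- ### the scale: the largest head moment, indexed by `D = (Fin 3 × Fin 3) × Fin 6`
  set M' : ℕ → (Fin 3 × Fin 3) × Fin 6 → ℝ := fun ν d => if (d.2 : ℕ) < n d.1 then M ν d.1 d.2 else 0 with hM'
  set N : ℕ → ℝ := fun ν => (univ : Finset ((Fin 3 × Fin 3) × Fin 6)).sup' Finset.univ_nonempty (fun d => |M' ν d|) with hN
  have hdom : ∀ ν d, |M' ν d| ≤ N ν := fun ν d => Finset.le_sup' (fun d => |M' ν d|) (Finset.mem_univ d)
  have hatt : ∀ ν, ∃ d, |M' ν d| = N ν := by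
    intro ν
    obtain ⟨d, _, h⟩ := Finset.exists_mem_eq_sup' (Finset.univ_nonempty (α := (Fin 3 × Fin 3) × Fin 6)) (fun d => |M' ν d|)
    exact ⟨d, h.symm⟩
  have hN0 : ∀ ν, 0 ≤ N ν := fun ν => (abs_nonneg _).trans (hdom ν ((0, 0), 0))
  have hheadN : ∀ ν k m, m < n k → |M ν k m| ≤ N ν := by
    intro ν k m hm
    have hm6 : m < 6 := lt_of_lt_of_le hm (hn_le k)
    have := hdom ν (k, ⟨m, hm6⟩)
    simp only [hM', hm, if_true] at this
    exact this
  -- ### positivity of the scale at levels with `2 s ≤ 1/2` (all moments vanish ⇒ the pencil determinant vanishes identically)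
  have hNpos : ∀ ν, 2 * s ν ≤ 1 / 2 → 0 < N ν := by
    intro ν hsν
    rcases (hN0 ν).lt_or_eq with h | h
    · exact h
    exfalso
    have hhead0 : ∀ k m, m < n k → M ν k m = 0 := by
      intro k m hm; have := hheadN ν k m hm; rw [← h] at this; exact abs_eq_zero.mp (le_antisymm this (abs_nonneg _))
    have hall0 : ∀ k m, M ν k m = 0 := by
      intro k m
      by_cases hm : m < n k
      · exact hhead0 k m hm
      · have ht := htail_lvl ν hsν k m (not_lt.mp hm)
        have hS : ∑ j ∈ Finset.range (n k), |M ν k j| = 0 :=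
          Finset.sum_eq_zero fun j hj => by rw [hhead0 k j (Finset.mem_range.mp hj), abs_zero]
        rw [hS, mul_zero] at ht
        exact abs_eq_zero.mp (le_antisymm ht (abs_nonneg _))
    -- every class function vanishes, hence the determinant
    obtain ⟨t, ht⟩ := hne ν
    apply ht
    rw [weyl321_det_eq_memberSum]
    have hident := iteratedDeriv_normalisedSum_eq_classes cls (a ν) (ε ν) (wν ν) 1 0 t
    rw [iteratedDeriv_zero] at hident
    have hfun : (∑ i : Fin 6 × Fin 6, polar (U ν i.1) (U ν i.2) *
        Real.exp (((δs ν (pos (v i.1)) + δs ν (pos (v i.2)))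
          + ((δs ν i.1 - δs ν (pos (v i.1))) + (δs ν i.2 - δs ν (pos (v i.2))))) * t))
        = (∑ i, a ν i * Real.exp ((wν ν (cls i) + ε ν i) * t)) / 1 := by
      rw [div_one]
    rw [hfun, hident]
    refine Finset.sum_eq_zero fun k _ => ?_
    rw [Finset.sum_range_one, div_one]
    have hser := hasSum_momentSeries (fun i => if cls i = k then a ν i else 0) (ε ν) 0 t
    have hzero : (fun j : ℕ => (∑ i, (if cls i = k then a ν i else 0) * ε ν i ^ (0 + j)) * t ^ j / (j.factorial : ℝ)) = fun _ => 0 := by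
      funext j; rw [zero_add, show (∑ i, (if cls i = k then a ν i else 0) * ε ν i ^ j) = M ν k j from rfl, hall0 k j]; simp
    rw [hzero] at hser
    have h0 : ∑ i, (if cls i = k then a ν i else 0) * ε ν i ^ 0 * Real.exp (ε ν i * t) = 0 := hser.unique hasSum_zero
    rw [h0, mul_zero, mul_zero]
  -- ### shift to levels with `2 s ≤ 1/2`, then ONE compactness extraction
  obtain ⟨ν₀, hν₀⟩ : ∃ ν₀, ∀ ν, ν₀ ≤ ν → 2 * s ν ≤ 1 / 2 := by
    have h2s : Tendsto (fun ν => 2 * s ν) atTop (𝓝 0) := by simpa using hslim.const_mul 2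
    have hev : ∀ᶠ ν in atTop, 2 * s ν ≤ 1 / 2 := h2s.eventually (Iic_mem_nhds (by norm_num : (0 : ℝ) < 1 / 2))
    exact eventually_atTop.mp hev
  obtain ⟨φ₁, hφ₁, cD, hcD, -, ⟨d₁, hd₁⟩⟩ := levelSelection_multi (fun l d => M' (l + ν₀) d) (fun l => N (l + ν₀))
    (fun l => hNpos _ (hν₀ _ (Nat.le_add_left _ _))) (fun l d => hdom _ d) (fun l => hatt _)
  set φ : ℕ → ℕ := fun l => φ₁ l + ν₀ with hφ
  have hφmono : StrictMono φ := fun a b hab => by simp only [hφ]; exact Nat.add_lt_add_right (hφ₁ hab) _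
  have hφge : ∀ l, ν₀ ≤ φ l := fun l => Nat.le_add_left _ _
  have hφtop : Tendsto φ atTop atTop := hφmono.tendsto_atTop
  have hNφ : ∀ l, 0 < N (φ l) := fun l => hNpos _ (hν₀ _ (hφge l))
  set c : Fin 3 × Fin 3 → ℕ → ℝ := fun k m => if h : m < 6 then cD (k, ⟨m, h⟩) else 0 with hc
  have hmom : ∀ k m, m < n k → Tendsto (fun l => M (φ l) k m / N (φ l)) atTop (𝓝 (c k m)) := by
    intro k m hm
    have hm6 : m < 6 := lt_of_lt_of_le hm (hn_le k)
    have h := hcD (k, ⟨m, hm6⟩)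
    simp only [hM', hm, if_true] at h
    simp only [hc, hm6, dif_pos]
    exact h
  have hcsymm : ∀ k m, c k.swap m = c k m := by
    intro k m
    by_cases hm6 : m < 6
    · simp only [hc, hm6, dif_pos]
      have h1 := hcD (k.swap, ⟨m, hm6⟩)
      have h2 := hcD (k, ⟨m, hm6⟩)
      have heq : (fun l => M' (φ₁ l + ν₀) (k.swap, ⟨m, hm6⟩) / N (φ₁ l + ν₀)) = fun l => M' (φ₁ l + ν₀) (k, ⟨m, hm6⟩) / N (φ₁ l + ν₀) := by
        funext l; simp only [hM', hn_swap, hMswap]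
      rw [heq] at h1
      exact tendsto_nhds_unique h1 h2
    · simp only [hc, hm6, dif_neg, not_false_eq_true]
  have hcne : ∃ k m, m < n k ∧ c k m ≠ 0 := by
    obtain ⟨k, m⟩ := d₁
    refine ⟨k, m, ?_, ?_⟩
    · by_contra hm
      have hz : ∀ l, M' (φ₁ l + ν₀) (k, m) / N (φ₁ l + ν₀) = 0 := by
        intro l; simp only [hM', hm, if_false, zero_div]
      have h := hcD (k, m)
      rw [show (fun l => M' (φ₁ l + ν₀) (k, m) / N (φ₁ l + ν₀)) = fun _ => (0 : ℝ) from funext hz] at h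
      have := tendsto_nhds_unique h tendsto_const_nhds
      rw [this, abs_zero] at hd₁; exact zero_ne_one hd₁
    · simp only [hc, m.isLt, dif_pos, Fin.eta]
      intro h0; rw [h0, abs_zero] at hd₁; exact zero_ne_one hd₁
  -- ### the class towers (#82) and the assembly (#83)
  have hclass : ∀ (k : Fin 3 × Fin 3) (r : ℕ) (ψ : ℕ → ℕ), StrictMono ψ → ∀ (R : ℝ) (t : ℕ → ℝ) (t₀ : ℝ), (∀ l, |t l| ≤ R) →
      Tendsto t atTop (𝓝 t₀) →
      Tendsto (fun l => (∑ i, (if cls i = k then a (φ (ψ l)) i else 0) * ε (φ (ψ l)) i ^ r * Real.exp (ε (φ (ψ l)) i * t l))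
        / N (φ (ψ l))) atTop (𝓝 (∑ m ∈ Finset.range (n k - r), c k (r + m) * t₀ ^ m / (m.factorial : ℝ))) := by
    intro k r ψ hψ R t t₀ htR htlim
    refine momentTower_limit (n k) (fun l i => if cls i = k then a (φ l) i else 0) (fun l => ε (φ l)) (fun l => N (φ l))
      (fun l => Ct * (2 * s (φ l)) * 6) (c k) hNφ (fun m hm => hmom k m hm) ?_ ?_ r ψ hψ R t t₀ htR htlim
    · intro l m hm
      have h := htail_lvl (φ l) (hν₀ _ (hφge l)) k m hm
      refine h.trans ?_
      have hS : ∑ j ∈ Finset.range (n k), |M (φ l) k j| ≤ 6 * N (φ l) := by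
        calc ∑ j ∈ Finset.range (n k), |M (φ l) k j| ≤ ∑ _j ∈ Finset.range (n k), N (φ l) :=
              Finset.sum_le_sum fun j hj => hheadN _ k j (Finset.mem_range.mp hj)
          _ ≤ ∑ _j ∈ Finset.range 6, N (φ l) :=
              Finset.sum_le_sum_of_subset_of_nonneg (Finset.range_subset_range.mpr (hn_le k)) fun _ _ _ => hN0 _
          _ = 6 * N (φ l) := by rw [Finset.sum_const, Finset.card_range, nsmul_eq_mul]; norm_num
      have hCt0 : 0 ≤ Ct * (2 * s (φ l)) := mul_nonneg (le_trans hC6₀ hC6t) (by positivity)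
      calc Ct * (2 * s (φ l)) * ∑ j ∈ Finset.range (n k), |M (φ l) k j| ≤ Ct * (2 * s (φ l)) * (6 * N (φ l)) :=
            mul_le_mul_of_nonneg_left hS hCt0
        _ = Ct * (2 * s (φ l)) * 6 * N (φ l) := by ring
    · have := (hslim.comp hφtop).const_mul (Ct * 2) |>.mul_const 6
      simp only [mul_zero, zero_mul] at this
      refine this.congr fun l => ?_
      simp only [Function.comp_apply]; ring
  have hwlim : ∀ k, Tendsto (fun l => wν (φ l) k) atTop (𝓝 (w k)) :=
    fun k => ((hδ _).comp hφtop).add ((hδ _).comp hφtop)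
  have hconv := classLimit_iteratedDeriv cls (fun l => a (φ l)) (fun l => ε (φ l)) (fun l => wν (φ l)) w (fun l => N (φ l)) n c
    hwlim hclass
  -- ### the rigidity dichotomy (#88, with both outside letters = the single)
  have hdich : c (2, 2) 5 = 0 ∨ c (1, 1) 0 = 0 := by
    by_contra hcon
    push Not at hcon
    obtain ⟨hc5, hcd⟩ := hcon
    refine weylTriple_dichotomy (fun l => V (φ l)) (fun l p => hVsymm _ p) (fun l => x (φ l)) (fun p => (hxlim p).comp hφtop)
      (fun l => U (φ l) 2) (fun l => U (φ l) 2) (fun l => hU _ _) (fun l => hU _ _)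
      (fun l => N (φ l)) hNφ ?_ (c (2, 2) 5) hc5 ?_ ?_ ?_ (c (1, 1) 0) hcd ?_
    · intro l m hm
      rw [← hM33]; exact hheadN _ (2, 2) m (by rw [hn22]; omega)
    · have h := hmom (2, 2) 5 (by rw [hn22]; norm_num)
      exact h.congr fun l => by rw [hM33]
    · intro l m hm
      rw [← hM12]; exact hheadN _ (1, 2) m (by rw [hn12]; omega)
    · intro l m hm
      rw [← hM21]; exact hheadN _ (2, 1) m (by rw [show n (2, 1) = n (1, 2) from hn_swap (1, 2), hn12]; omega)
    · have h := hmom (1, 1) 0 (hn_pos _)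
      exact h.congr fun l => by rw [hM11, pow_zero, mul_one]
  -- ### conclusion
  refine ⟨φ, hφmono, fun l => (N (φ l))⁻¹, c, hcsymm, hcne, hdich, ?_⟩
  intro j ψ hψ ts t₀ hts
  obtain ⟨R, hR⟩ : ∃ R, ∀ l, |ts l| ≤ R := by
    obtain ⟨R, hR⟩ := (Metric.isBounded_range_of_tendsto ts hts).subset_closedBall (0 : ℝ)
    exact ⟨R, fun l => by simpa [Real.dist_eq] using hR (Set.mem_range_self l)⟩
  have h := hconv j ψ hψ R ts t₀ hR hts
  have hfun : ∀ l, (fun t => (N (φ (ψ l)))⁻¹ * (∑ i, Real.exp (δs (φ (ψ l)) i * t) • U (φ (ψ l)) i).det)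
      = fun s' => (∑ i, a (φ (ψ l)) i * Real.exp ((wν (φ (ψ l)) (cls i) + ε (φ (ψ l)) i) * s')) / N (φ (ψ l)) := by
    intro l; funext s'
    rw [weyl321_det_eq_memberSum, div_eq_inv_mul]
  simp only [hfun]
  exact h

end Summit.ValiantsHypothesis.ValiantsHypothesis.Theorems.LacunarySymmetroidMatrixDescartes.WallBubbling
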